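import Literature.Analysis.FluidPDE.DuchonRobert
import Literature.Analysis.FluidPDE.DuchonRobertSmoothDefect
import Literature.Analysis.FunctionSpaces.TorusMollifier
import HarnessLib

/-!
# The Duchon–Robert defect vanishes in the Onsager class `L³_t B^α_{3,∞}`, `α > 1/3`

Analysis/FluidPDE proof file; sibling of `DuchonRobert` (the statement file of turb.S17, kept free
of the mollifier calculus this proof imports: `DuchonRobertSmoothDefect`, `TorusMollifier`) and of
`DuchonRobertProofs` (which hosts the turb.S18 discharge). It **discharges** the named fact
`Literature.Analysis.FluidPDE.duchon_robert_defect_zero_of_besov`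
(`duchon_robert_defect_zero_of_besov_holds`): if `u ∈ L³(0,T; B^α_{3,∞}(T^d))` with `α > 1/3`
(`MemLpBesovSup 3 α 3 u volume (Ioo 0 T)`) has a Duchon–Robert defect `D`
(`Torus.HasDuchonRobertDefect T u D`), then `D ψ = 0` for every test function `ψ` supported in
`(0, T)`. (The other turb.S17 fact, `duchon_robert_defect_exists`, is discharged in
`DuchonRobertInviscidLimitProofs`.)

## The argument (Constantin–E–Titi 1994, (6)–(8) and (11); Duchon–Robert 2000, Prop. 2 ff.)

Fix a mollifier `φ` and `ε > 0`. For a slice `v : T^d → ℝ^d`,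
`|D_ε(v)(x)| ≤ ¼ ∫ |∇φ^ε(ξ)| |δv(x;ξ)|³ dξ`, so by Tonelli on `T^d × ℝ^d` (translation invariance of
Haar measure on `T^d` makes `(x, ξ) ↦ v(x + ξ)` measurable)
`∫ |D_ε(v)| dx ≤ ¼ ∫ |∇φ^ε(ξ)| ‖δ_ξ v‖³_{L³} dξ`.
The defining Besov estimate `‖δ_ξ v‖_{L³} ≤ |ξ|^α [v]_{B^α_{3,∞}}` (CET 1994, (6); on the torus the
quotient norm of `ξ mod ℤ^d` is `≤ |ξ|`) and the scaling `∇φ^ε(ξ) = ε^{-d-1}(∇φ)(ξ/ε)` give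
`∫ |∇φ^ε(ξ)| |ξ|^{3α} dξ = ε^{3α-1} ∫ |∇φ(η)| |η|^{3α} dη =: ε^{3α-1} M`, whence
`∫ |D_ε(v)| dx ≤ ¼ M ε^{3α-1} [v]³_{B^α_{3,∞}}`. Integrating in time against a bounded `ψ`,
`|∫₀ᵀ∫ D_ε(u) ψ| ≤ ¼ M ‖ψ‖_∞ ε^{3α-1} ∫₀ᵀ [u(t)]³_{B^α_{3,∞}} dt → 0` (`3α - 1 > 0`; the time
integral is `≤ ‖u‖³_{L³_t B^α_{3,∞}} < ∞`), and `D ψ = lim_{ε→0⁺} ∫₀ᵀ∫ D_ε(u) ψ = 0` by uniqueness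
of limits. All estimates are carried out with lower Lebesgue integrals (`∫⁻`), so no measurability
in time and no integrability of the Bochner integrands is needed; in particular the joint
measurability hypothesis of the fact is not used.

## References

* P. Constantin, W. E, E. S. Titi, *Onsager's conjecture on the energy conservation for solutions
  of Euler's equation*, Comm. Math. Phys. 165 (1994) 207–209: Theorem (p. 207), (6)–(8), (11)
  (`u ∈ L³(0,T; B^α_{3,∞})`, `α > 1/3`). [Titi1994]
* J. Duchon, R. Robert, *Inertial energy dissipation for weak solutions of incompressible Euler
  and Navier–Stokes equations*, Nonlinearity 13 (2000) 249–255: (9), Prop. 2 and the discussion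
  following it (`D(u) = 0` under `∫|δ_ξ u|³ ≤ C(t)|ξ|σ(|ξ|)`, restated as (8.2) on p. 226 of
  Robinson–Rodrigo–Skipper, in *Partial Differential Equations in Fluid Mechanics*, LMS Lecture
  Notes 452 (2018)). [DuchonRobert2000]

Tree anchors: `DissipationAnomaly` (`duchonRobertApprox`, `HasDuchonRobertDefect`),
`DuchonRobertSmoothDefect` (`norm_gradient_mollifierScale`), `BesovDifference`
(`eLpNorm_sub_le_eBesovSupSeminorm_mul`), `TorusMollifier` (`norm_proj_le`).
-/

noncomputable section

open MeasureTheory MeasureTheory.Measure Set Filter Topology Function Metric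
open scoped ENNReal NNReal RealInnerProductSpace ContDiff

namespace Literature.Analysis.FluidPDE

open Literature.Analysis.FunctionSpaces

variable {d : Type*} [Fintype d]

namespace Torus

/-! ### The rescaled mollifier: the moment `∫ |∇φ^ε| |ξ|^β = ε^{β-1} ∫ |Dφ| |η|^β` -/

section Scaling

variable {φ : EuclideanSpace ℝ d → ℝ} {ε β : ℝ}

/-- The integrand of the `β`-moment of `|∇φ^ε|` is `ε^{β-1}` times the rescaling of
`η ↦ |Dφ(η)| |η|^β` (`∇φ^ε(ξ) = ε^{-d-1} (∇φ)(ξ/ε)`, `|ξ|^β = ε^β |ξ/ε|^β`). [folklore] -/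
theorem norm_gradient_mollifierScale_mul_rpow (hφ : Differentiable ℝ φ) (hε : 0 < ε) (β : ℝ)
    (ξ : EuclideanSpace ℝ d) :
    ‖gradient (FluidPDE.mollifierScale ε φ) ξ‖ * ‖ξ‖ ^ β =
      ε ^ (β - 1) * FluidPDE.mollifierScale ε (fun η => ‖_root_.fderiv ℝ φ η‖ * ‖η‖ ^ β) ξ := by
  rw [norm_gradient_mollifierScale hφ hε, FluidPDE.mollifierScale_apply, norm_smul, norm_inv,
    Real.norm_of_nonneg hε.le, Real.mul_rpow (inv_nonneg.2 hε.le) (norm_nonneg _),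
    Real.inv_rpow hε.le, Real.rpow_sub_one hε.ne']
  have hb : ε ^ β ≠ 0 := (Real.rpow_pos_of_pos hε β).ne'
  field_simp

/-- **The `β`-moment of the gradient of the rescaled mollifier**:
`∫ |∇φ^ε(ξ)| |ξ|^β dξ = ε^{β-1} ∫ |Dφ(η)| |η|^β dη` (`ε > 0`; Haar rescaling). [folklore] -/
theorem integral_norm_gradient_mollifierScale_mul_rpow (hφ : Differentiable ℝ φ) (hε : 0 < ε)
    (β : ℝ) :
    ∫ ξ, ‖gradient (FluidPDE.mollifierScale ε φ) ξ‖ * ‖ξ‖ ^ β =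
      ε ^ (β - 1) * ∫ η, ‖_root_.fderiv ℝ φ η‖ * ‖η‖ ^ β := by
  simp_rw [norm_gradient_mollifierScale_mul_rpow hφ hε]
  rw [integral_const_mul, integral_mollifierScale_eq_integral _ hε]

/-- The moment density `η ↦ |Dφ(η)| |η|^β` (`β ≥ 0`) of a mollifier is integrable (continuous with
compact support). [folklore] -/
theorem integrable_norm_fderiv_mul_rpow (hφ : FluidPDE.IsMollifier φ) (hβ : 0 ≤ β) :
    Integrable (fun η : EuclideanSpace ℝ d => ‖_root_.fderiv ℝ φ η‖ * ‖η‖ ^ β) volume := by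
  refine Continuous.integrable_of_hasCompactSupport ?_ ?_
  · exact (hφ.1.continuous_fderiv (by simp)).norm.mul
      (continuous_norm.rpow_const fun _ => Or.inr hβ)
  · exact (hφ.2.1.fderiv (𝕜 := ℝ)).norm.mul_right

/-- The rescaled moment density `ξ ↦ |∇φ^ε(ξ)| |ξ|^β` is integrable (`ε > 0`, `β ≥ 0`). [folklore] -/
theorem integrable_norm_gradient_mollifierScale_mul_rpow (hφ : FluidPDE.IsMollifier φ)
    (hε : 0 < ε) (hβ : 0 ≤ β) :
    Integrable (fun ξ : EuclideanSpace ℝ d =>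
      ‖gradient (FluidPDE.mollifierScale ε φ) ξ‖ * ‖ξ‖ ^ β) volume := by
  have hd : Differentiable ℝ φ := hφ.1.differentiable (by simp)
  simp_rw [norm_gradient_mollifierScale_mul_rpow hd hε]
  refine Integrable.const_mul ?_ _
  exact ((integrable_norm_fderiv_mul_rpow hφ hβ).comp_smul (inv_ne_zero hε.ne')).const_mul
    ((ε ^ Fintype.card d)⁻¹)

/-- The moment in `ℝ≥0∞` form:
`∫⁻ ‖∇φ^ε(ξ)‖ₑ · |ξ|^β dξ = ofReal (ε^{β-1} ∫ |Dφ(η)| |η|^β dη)` (`ε > 0`, `β ≥ 0`). [folklore] -/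
theorem lintegral_enorm_gradient_mollifierScale_mul_rpow (hφ : FluidPDE.IsMollifier φ)
    (hε : 0 < ε) (hβ : 0 ≤ β) :
    ∫⁻ ξ, ‖gradient (FluidPDE.mollifierScale ε φ) ξ‖ₑ * ENNReal.ofReal (‖ξ‖ ^ β) =
      ENNReal.ofReal (ε ^ (β - 1) * ∫ η, ‖_root_.fderiv ℝ φ η‖ * ‖η‖ ^ β) := by
  have hd : Differentiable ℝ φ := hφ.1.differentiable (by simp)
  rw [← integral_norm_gradient_mollifierScale_mul_rpow hd hε β,
    ofReal_integral_eq_lintegral_ofReal (integrable_norm_gradient_mollifierScale_mul_rpow hφ hε hβ)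
      (ae_of_all _ fun ξ => mul_nonneg (norm_nonneg _) (Real.rpow_nonneg (norm_nonneg _) _))]
  refine lintegral_congr fun ξ => ?_
  rw [ENNReal.ofReal_mul (norm_nonneg _), ofReal_norm]

/-- The gradient of a rescaled mollifier `∇φ^ε` is continuous (`ε > 0`). [folklore] -/
theorem continuous_gradient_mollifierScale (hφ : FluidPDE.IsMollifier φ) (hε : 0 < ε) :
    Continuous fun ξ => gradient (FluidPDE.mollifierScale ε φ) ξ :=
  (InnerProductSpace.toDual ℝ (EuclideanSpace ℝ d)).symm.continuous.comp
    ((hφ.mollifierScale hε).1.continuous_fderiv (by simp))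

end Scaling

/-! ### Slices: measurability of translates and the `L³`/Besov bound of the flux -/

section Slice

variable {F : Type*} [NormedAddCommGroup F]

/-- `(x, ξ) ↦ x + (ξ mod ℤ^d)` is quasi measure preserving from `vol_{T^d} ⊗ vol_{ℝ^d}` to
`vol_{T^d}` (each `ξ`-section is a translation, hence measure preserving). [folklore] -/
theorem quasiMeasurePreserving_add_proj :
    QuasiMeasurePreserving
      (fun q : UnitAddTorus d × EuclideanSpace ℝ d => q.1 + FunctionSpaces.Torus.proj q.2)
      ((volume : Measure (UnitAddTorus d)).prod volume) volume := by
  refine QuasiMeasurePreserving.prod_of_left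
    (measurable_fst.add (FunctionSpaces.Torus.measurable_proj.comp measurable_snd))
    (ae_of_all _ fun ξ => ?_)
  exact (measurePreserving_add_right volume (FunctionSpaces.Torus.proj ξ)).quasiMeasurePreserving

omit [Fintype d] in
/-- Translates of an a.e.-strongly measurable slice are jointly a.e.-strongly measurable:
`(x, ξ) ↦ v(x + ξ)` on `T^d × ℝ^d`. [folklore] -/
theorem aestronglyMeasurable_comp_add_proj [Fintype d] {v : UnitAddTorus d → F}
    (hv : AEStronglyMeasurable v volume) :
    AEStronglyMeasurable
      (fun q : UnitAddTorus d × EuclideanSpace ℝ d => v (q.1 + FunctionSpaces.Torus.proj q.2))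
      ((volume : Measure (UnitAddTorus d)).prod volume) :=
  hv.comp_quasiMeasurePreserving quasiMeasurePreserving_add_proj

/-- The increment field `(x, ξ) ↦ δv(x;ξ) = v(x + ξ) - v(x)` of an a.e.-strongly measurable slice
is jointly a.e.-strongly measurable on `T^d × ℝ^d`. [folklore] -/
theorem aestronglyMeasurable_increment_slice {v : UnitAddTorus d → F}
    (hv : AEStronglyMeasurable v volume) :
    AEStronglyMeasurable (fun q : UnitAddTorus d × EuclideanSpace ℝ d => increment v q.2 q.1)
      ((volume : Measure (UnitAddTorus d)).prod volume) :=
  (aestronglyMeasurable_comp_add_proj hv).sub hv.comp_fst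

/-- `‖⟪a, b⟫ |b|²‖ₑ ≤ ‖a‖ₑ ‖b‖ₑ³` (Cauchy–Schwarz). [folklore] -/
theorem enorm_inner_mul_norm_sq_le (a b : EuclideanSpace ℝ d) :
    ‖⟪a, b⟫ * ‖b‖ ^ 2‖ₑ ≤ ‖a‖ₑ * ‖b‖ₑ ^ 3 := by
  rw [Real.enorm_eq_ofReal_abs, ← ofReal_norm, ← ofReal_norm,
    ← ENNReal.ofReal_pow (norm_nonneg _), ← ENNReal.ofReal_mul (norm_nonneg _)]
  refine ENNReal.ofReal_le_ofReal ?_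
  rw [abs_mul, abs_of_nonneg (sq_nonneg ‖b‖)]
  calc |⟪a, b⟫| * ‖b‖ ^ 2 ≤ ‖a‖ * ‖b‖ * ‖b‖ ^ 2 := by
        gcongr
        exact abs_real_inner_le_norm a b
    _ = ‖a‖ * ‖b‖ ^ 3 := by ring

/-- **Pointwise bound of the Duchon–Robert flux**:
`‖D_ε(v)(x)‖ₑ ≤ ¼ ∫⁻ ‖∇φ^ε(ξ)‖ₑ ‖δv(x;ξ)‖ₑ³ dξ` (Duchon–Robert 2000, (9)). [folklore] -/
theorem enorm_duchonRobertApprox_le (φ : EuclideanSpace ℝ d → ℝ) (ε : ℝ)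
    (v : UnitAddTorus d → EuclideanSpace ℝ d) (x : UnitAddTorus d) :
    ‖duchonRobertApprox φ ε v x‖ₑ ≤
      ENNReal.ofReal 4⁻¹ *
        ∫⁻ ξ, ‖gradient (FluidPDE.mollifierScale ε φ) ξ‖ₑ * ‖increment v ξ x‖ₑ ^ 3 := by
  rw [duchonRobertApprox, enorm_mul, Real.enorm_eq_ofReal (by norm_num : (0 : ℝ) ≤ 4⁻¹)]
  gcongr
  exact (enorm_integral_le_lintegral_enorm _).trans
    (lintegral_mono fun ξ => enorm_inner_mul_norm_sq_le _ _)

/-- **`L¹` bound of the flux by Tonelli**: for an a.e.-strongly measurable slice `v` and `ε > 0`,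
`∫⁻ ‖D_ε(v)‖ₑ dx ≤ ¼ ∫⁻ ‖∇φ^ε(ξ)‖ₑ (∫⁻ ‖δv(x;ξ)‖ₑ³ dx) dξ`. [folklore] -/
theorem lintegral_enorm_duchonRobertApprox_le {φ : EuclideanSpace ℝ d → ℝ}
    (hφ : FluidPDE.IsMollifier φ) {ε : ℝ} (hε : 0 < ε)
    {v : UnitAddTorus d → EuclideanSpace ℝ d} (hv : AEStronglyMeasurable v volume) :
    ∫⁻ x, ‖duchonRobertApprox φ ε v x‖ₑ ≤
      ENNReal.ofReal 4⁻¹ *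
        ∫⁻ ξ, ‖gradient (FluidPDE.mollifierScale ε φ) ξ‖ₑ * ∫⁻ x, ‖increment v ξ x‖ₑ ^ 3 := by
  have hg := continuous_gradient_mollifierScale hφ hε
  have hmeas : AEMeasurable (fun q : UnitAddTorus d × EuclideanSpace ℝ d =>
      ‖gradient (FluidPDE.mollifierScale ε φ) q.2‖ₑ * ‖increment v q.2 q.1‖ₑ ^ 3)
      ((volume : Measure (UnitAddTorus d)).prod volume) :=
    (hg.measurable.comp measurable_snd).enorm.aemeasurable.mul
      ((aestronglyMeasurable_increment_slice hv).enorm.pow_const 3)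
  calc ∫⁻ x, ‖duchonRobertApprox φ ε v x‖ₑ
      ≤ ∫⁻ x, ENNReal.ofReal 4⁻¹ *
          ∫⁻ ξ, ‖gradient (FluidPDE.mollifierScale ε φ) ξ‖ₑ * ‖increment v ξ x‖ₑ ^ 3 :=
        lintegral_mono fun x => enorm_duchonRobertApprox_le φ ε v x
    _ = ENNReal.ofReal 4⁻¹ *
          ∫⁻ ξ, ∫⁻ x, ‖gradient (FluidPDE.mollifierScale ε φ) ξ‖ₑ * ‖increment v ξ x‖ₑ ^ 3 := by
        rw [lintegral_const_mul' _ _ ENNReal.ofReal_ne_top, lintegral_lintegral_swap hmeas]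
    _ = _ := by
        congr 1
        refine lintegral_congr fun ξ => ?_
        rw [lintegral_const_mul' _ _ enorm_ne_top]

/-- `∫⁻ ‖f‖ₑ³ = ‖f‖³_{L³}`. [folklore] -/
theorem lintegral_enorm_pow_three_eq {X : Type*} [MeasurableSpace X] {μ : Measure X}
    {G : Type*} [NormedAddCommGroup G] (f : X → G) :
    ∫⁻ a, ‖f a‖ₑ ^ 3 ∂μ = eLpNorm f 3 μ ^ 3 := by
  have h := lintegral_rpow_enorm_eq_rpow_eLpNorm' (μ := μ) (f := f) (q := 3) (by norm_num)
  rw [eLpNorm_eq_eLpNorm' (by norm_num) (by norm_num), ENNReal.toReal_ofNat, ← ENNReal.rpow_ofNat,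
    ← h]
  exact lintegral_congr fun a => (ENNReal.rpow_ofNat _ 3).symm

/-- `(r^α)³ = r^{3α}` for `r ≥ 0`. [folklore] -/
theorem rpow_pow_three {r : ℝ} (hr : 0 ≤ r) (α : ℝ) : (r ^ α) ^ 3 = r ^ (3 * α) := by
  rw [← Real.rpow_mul_natCast hr, mul_comm]
  norm_num

/-- **The Besov bound of increments** (Constantin–E–Titi 1994, (6):
`‖u(· + y) - u‖_{L³} ≤ C |y|^α ‖u‖_{B^α_{3,∞}}`): on `T^d`,
`∫⁻ ‖δv(x;ξ)‖ₑ³ dx ≤ ([v]_{B^α_{3,∞}} |ξ|^α)³` for `α ≥ 0` (the shift acts through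
`ξ mod ℤ^d`, whose quotient norm is `≤ |ξ|`; for `ξ ∈ ℤ^d` the increment vanishes). [cite: Titi1994, eq. (6) p. 208] -/
theorem lintegral_enorm_increment_pow_three_le (v : UnitAddTorus d → F) {α : ℝ} (hα : 0 ≤ α)
    (ξ : EuclideanSpace ℝ d) :
    ∫⁻ x, ‖increment v ξ x‖ₑ ^ 3 ≤
      (eBesovSupSeminorm α 3 v volume * ENNReal.ofReal (‖ξ‖ ^ α)) ^ 3 := by
  by_cases h0 : FunctionSpaces.Torus.proj ξ = 0
  · simp [increment, h0]
  rw [lintegral_enorm_pow_three_eq]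
  gcongr
  calc eLpNorm (increment v ξ) 3 volume
      ≤ eBesovSupSeminorm α 3 v volume * ENNReal.ofReal (‖FunctionSpaces.Torus.proj ξ‖ ^ α) :=
        eLpNorm_sub_le_eBesovSupSeminorm_mul h0
    _ ≤ eBesovSupSeminorm α 3 v volume * ENNReal.ofReal (‖ξ‖ ^ α) := by
        gcongr
        exact FunctionSpaces.Torus.norm_proj_le ξ

/-- **Slice estimate** (Constantin–E–Titi 1994, (11); Duchon–Robert 2000, Prop. 2 ff.:
`|D_ε(u)| ≤ C ε^{3α-1}`): for an a.e.-strongly measurable slice `v`, a mollifier `φ`, `ε > 0` and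
`α ≥ 0`,
`∫⁻ ‖D_ε(v)‖ₑ dx ≤ ¼ ε^{3α-1} (∫ |Dφ(η)| |η|^{3α} dη) · [v]³_{B^α_{3,∞}}`. [cite: Titi1994, eq. (11) p. 209] -/
theorem lintegral_enorm_duchonRobertApprox_le_besov {φ : EuclideanSpace ℝ d → ℝ}
    (hφ : FluidPDE.IsMollifier φ) {ε : ℝ} (hε : 0 < ε)
    {v : UnitAddTorus d → EuclideanSpace ℝ d} (hv : AEStronglyMeasurable v volume)
    {α : ℝ} (hα : 0 ≤ α) :
    ∫⁻ x, ‖duchonRobertApprox φ ε v x‖ₑ ≤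
      ENNReal.ofReal (4⁻¹ * (ε ^ (3 * α - 1) * ∫ η, ‖_root_.fderiv ℝ φ η‖ * ‖η‖ ^ (3 * α))) *
        eBesovSupSeminorm α 3 v volume ^ 3 := by
  have h3α : 0 ≤ 3 * α := by positivity
  have hg := continuous_gradient_mollifierScale hφ hε
  have hmeasφ : Measurable fun ξ : EuclideanSpace ℝ d =>
      ‖gradient (FluidPDE.mollifierScale ε φ) ξ‖ₑ * ENNReal.ofReal (‖ξ‖ ^ (3 * α)) :=
    hg.measurable.enorm.mul
      (continuous_norm.rpow_const fun _ => Or.inr h3α).measurable.ennreal_ofReal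
  set B : ℝ≥0∞ := eBesovSupSeminorm α 3 v volume with hB
  calc ∫⁻ x, ‖duchonRobertApprox φ ε v x‖ₑ
      ≤ ENNReal.ofReal 4⁻¹ *
          ∫⁻ ξ, ‖gradient (FluidPDE.mollifierScale ε φ) ξ‖ₑ * ∫⁻ x, ‖increment v ξ x‖ₑ ^ 3 :=
        lintegral_enorm_duchonRobertApprox_le hφ hε hv
    _ ≤ ENNReal.ofReal 4⁻¹ *
          ∫⁻ ξ, ‖gradient (FluidPDE.mollifierScale ε φ) ξ‖ₑ * (B * ENNReal.ofReal (‖ξ‖ ^ α)) ^ 3 := by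
        gcongr with ξ
        exact lintegral_enorm_increment_pow_three_le v hα ξ
    _ = ENNReal.ofReal 4⁻¹ *
          ∫⁻ ξ, ‖gradient (FluidPDE.mollifierScale ε φ) ξ‖ₑ * ENNReal.ofReal (‖ξ‖ ^ (3 * α)) *
            B ^ 3 := by
        congr 1
        refine lintegral_congr fun ξ => ?_
        rw [mul_pow, ← ENNReal.ofReal_pow (Real.rpow_nonneg (norm_nonneg _) _),
          rpow_pow_three (norm_nonneg _)]
        ring
    _ = ENNReal.ofReal 4⁻¹ *
          ((∫⁻ ξ, ‖gradient (FluidPDE.mollifierScale ε φ) ξ‖ₑ * ENNReal.ofReal (‖ξ‖ ^ (3 * α))) *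
            B ^ 3) := by
        rw [lintegral_mul_const _ hmeasφ]
    _ = _ := by
        rw [lintegral_enorm_gradient_mollifierScale_mul_rpow hφ hε h3α, ← mul_assoc,
          ← ENNReal.ofReal_mul (by norm_num)]

end Slice

end Torus

/-! ### The discharge -/

section Discharge

variable {T : ℝ} {u : ℝ → UnitAddTorus d → EuclideanSpace ℝ d}

/-- **Discharge of `duchon_robert_defect_zero_of_besov`** (turb.S17; Constantin–E–Titi 1994,
Theorem p. 207 with (6)–(8), (11); Duchon–Robert 2000, Prop. 2 ff.): if
`u ∈ L³(0,T; B^α_{3,∞}(T^d))` with `α > 1/3` has Duchon–Robert defect `D`, then `D ψ = 0` for every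
test function `ψ` supported in `(0,T)`. Indeed, for any mollifier `φ`,
`|∫₀ᵀ∫ D_ε(u) ψ| ≤ ¼ (∫|Dφ||η|^{3α}) (sup|ψ|) (∫₀ᵀ [u(t)]³_{B^α_{3,∞}}) ε^{3α-1} → 0` as `ε → 0⁺`
(`Torus.lintegral_enorm_duchonRobertApprox_le_besov` slice-wise, at the a.e. times where
`u(t) ∈ B^α_{3,∞}`), while the same pairings tend to `D ψ` by definition of the defect. The joint
measurability hypothesis of the fact is not needed. [cite: Titi1994, Theorem p. 207 and eqs. (6)–(8), (11)] -/
theorem duchon_robert_defect_zero_of_besov_holds :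
    duchon_robert_defect_zero_of_besov (d := d) (T := T) (u := u) := by
  intro D hD _hmeas α hu hα ψ hψ
  obtain ⟨φ, hφ⟩ := FluidPDE.exists_isMollifier (d := d)
  refine tendsto_nhds_unique (hD φ hφ ψ hψ) ?_
  rcases le_or_gt T 0 with hT | hT
  · simp only [Ioo_eq_empty_of_le hT, Measure.restrict_empty, integral_zero_measure]
    exact tendsto_const_nhds
  -- a bound for the test function on `[0, T]`
  have hψsm : FunctionSpaces.Torus.IsSmoothSpaceTimeOn (Icc 0 T) ψ :=
    FunctionSpaces.Torus.isSmoothSpaceTimeOn_of_contDiff hψ.1.1 (Icc 0 T)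
  obtain ⟨Cψ, hCψ⟩ := hψsm.exists_norm_le_of_isCompact isCompact_Icc subset_rfl
  have hCψ0 : 0 ≤ Cψ := (norm_nonneg _).trans (hCψ 0 ⟨le_rfl, hT.le⟩ 0)
  -- constants
  have hα0 : 0 ≤ α := by linarith
  have h3α : 0 < 3 * α - 1 := by linarith
  set M : ℝ := ∫ η, ‖_root_.fderiv ℝ φ η‖ * ‖η‖ ^ (3 * α) with hM
  have hM0 : 0 ≤ M := integral_nonneg fun η => by positivity
  -- the time integral of the cubed Besov seminorm is finite
  set S : ℝ≥0∞ := ∫⁻ t in Ioo 0 T, eBesovSupSeminorm α 3 (u t) volume ^ 3 with hS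
  have hS_lt : S < ⊤ := by
    calc S ≤ ∫⁻ t in Ioo 0 T, ‖(eBesovSupNorm α 3 (u t) volume).toReal‖ₑ ^ 3 := by
          refine lintegral_mono_ae ?_
          filter_upwards [hu.1] with t ht
          gcongr
          rw [Real.enorm_eq_ofReal ENNReal.toReal_nonneg,
            ENNReal.ofReal_toReal ht.eBesovSupNorm_lt_top.ne]
          exact le_add_self
      _ = eLpBesovSupNorm 3 α 3 u volume (Ioo 0 T) ^ 3 := by
          rw [Torus.lintegral_enorm_pow_three_eq]
          rfl
      _ < ⊤ := ENNReal.pow_lt_top hu.2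
  -- the `O(ε^{3α-1})` bound of the pairing
  have hbound : ∀ ε : ℝ, 0 < ε →
      ‖∫ t in Ioo 0 T, ∫ x, Torus.duchonRobertApprox φ ε (u t) x * ψ t x‖ ≤
        4⁻¹ * (ε ^ (3 * α - 1) * M) * Cψ * S.toReal := by
    intro ε hε
    have hA0 : 0 ≤ 4⁻¹ * (ε ^ (3 * α - 1) * M) :=
      mul_nonneg (by norm_num) (mul_nonneg (Real.rpow_nonneg hε.le _) hM0)
    set K : ℝ≥0∞ := ENNReal.ofReal (4⁻¹ * (ε ^ (3 * α - 1) * M)) * ENNReal.ofReal Cψ with hK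
    have hK' : K ≠ ⊤ := ENNReal.mul_ne_top ENNReal.ofReal_ne_top ENNReal.ofReal_ne_top
    -- slice-wise bound at a.e. time
    have hslice : ∀ᵐ t ∂(volume.restrict (Ioo 0 T)),
        ‖∫ x, Torus.duchonRobertApprox φ ε (u t) x * ψ t x‖ₑ ≤
          K * eBesovSupSeminorm α 3 (u t) volume ^ 3 := by
      filter_upwards [hu.1, ae_restrict_mem measurableSet_Ioo] with t ht htI
      have htI' : t ∈ Icc 0 T := Ioo_subset_Icc_self htI
      calc ‖∫ x, Torus.duchonRobertApprox φ ε (u t) x * ψ t x‖ₑ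
          ≤ ∫⁻ x, ‖Torus.duchonRobertApprox φ ε (u t) x‖ₑ * ENNReal.ofReal Cψ := by
            refine (enorm_integral_le_lintegral_enorm _).trans (lintegral_mono fun x => ?_)
            rw [enorm_mul]
            gcongr
            rw [← ofReal_norm]
            exact ENNReal.ofReal_le_ofReal (hCψ t htI' x)
        _ = (∫⁻ x, ‖Torus.duchonRobertApprox φ ε (u t) x‖ₑ) * ENNReal.ofReal Cψ :=
            lintegral_mul_const' _ _ ENNReal.ofReal_ne_top
        _ ≤ ENNReal.ofReal (4⁻¹ * (ε ^ (3 * α - 1) * M)) * eBesovSupSeminorm α 3 (u t) volume ^ 3 *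
              ENNReal.ofReal Cψ := by
            gcongr
            exact Torus.lintegral_enorm_duchonRobertApprox_le_besov hφ hε
              ht.memLp.aestronglyMeasurable hα0
        _ = K * eBesovSupSeminorm α 3 (u t) volume ^ 3 := by
            rw [hK]
            ring
    -- integrate in time
    have hP : ‖∫ t in Ioo 0 T, ∫ x, Torus.duchonRobertApprox φ ε (u t) x * ψ t x‖ₑ ≤ K * S :=
      calc ‖∫ t in Ioo 0 T, ∫ x, Torus.duchonRobertApprox φ ε (u t) x * ψ t x‖ₑ
          ≤ ∫⁻ t in Ioo 0 T, K * eBesovSupSeminorm α 3 (u t) volume ^ 3 :=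
            (enorm_integral_le_lintegral_enorm _).trans (lintegral_mono_ae hslice)
        _ = K * S := by rw [lintegral_const_mul' _ _ hK']
    have hfin : K * S ≠ ⊤ := ENNReal.mul_ne_top hK' hS_lt.ne
    calc ‖∫ t in Ioo 0 T, ∫ x, Torus.duchonRobertApprox φ ε (u t) x * ψ t x‖
        = ‖∫ t in Ioo 0 T, ∫ x, Torus.duchonRobertApprox φ ε (u t) x * ψ t x‖ₑ.toReal :=
          (toReal_enorm _).symm
      _ ≤ (K * S).toReal := ENNReal.toReal_mono hfin hP
      _ = 4⁻¹ * (ε ^ (3 * α - 1) * M) * Cψ * S.toReal := by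
          rw [ENNReal.toReal_mul, hK, ENNReal.toReal_mul, ENNReal.toReal_ofReal hA0,
            ENNReal.toReal_ofReal hCψ0]
  -- squeeze
  refine squeeze_zero_norm' (eventually_nhdsWithin_of_forall fun ε hε => hbound ε hε) ?_
  have hcont : ContinuousAt (fun ε : ℝ => ε ^ (3 * α - 1)) 0 :=
    Real.continuousAt_rpow_const 0 _ (Or.inr h3α.le)
  have hc : Tendsto (fun ε : ℝ => 4⁻¹ * (ε ^ (3 * α - 1) * M) * Cψ * S.toReal) (𝓝 0)
      (𝓝 (4⁻¹ * ((0 : ℝ) ^ (3 * α - 1) * M) * Cψ * S.toReal)) :=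
    (((hcont.tendsto.mul_const M).const_mul 4⁻¹).mul_const Cψ).mul_const S.toReal
  rw [Real.zero_rpow h3α.ne', zero_mul, mul_zero, zero_mul, zero_mul] at hc
  exact hc.mono_left nhdsWithin_le_nhds

end Discharge

end Literature.Analysis.FluidPDE
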